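import Literature.Barriers.CriticalPhenomena.LaceExpansionXSpaceAsymptotics
import Literature.Barriers.CriticalPhenomena.LaceExpansionHighDimensionProofs
import Mathlib.Analysis.SpecialFunctions.Pow.Deriv
import Mathlib.Analysis.Calculus.MeanValue
import HarnessLib

/-!
# Lattice sums and kernel bounds for Hara's convolution lemma (Hara 2008, Lemma 6.1)

Barrier catalogue `Literature/Barriers/CriticalPhenomena/` (D-0021), companion of
`LaceExpansionXSpaceAsymptotics.lean`, which reduces the named fact `Hara2008_etaZeroXSpace`
(Heydenreich–van der Hofstad 2017, Thm. 11.4: `η = 0` in `x`-space for `d ≥ 11`) to Hara's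
Gaussian lemma in convolution form (`Hara2008_gaussianConvolution` = Hara 2008, Cor. 1.4) and the
lace-expansion input. Cor. 1.4 "follows immediately from Theorem 1.3 and a basic property of
convolutions, Lemma 6.1(ii)" (Hara 2008, §1.2.2; Lemma 6.1 = Hara–van der Hofstad–Slade 2003,
Prop. 1.7). This file and `LaceExpansionConvolutionAsymptotics.lean` PROVE that convolution
property; `LaceExpansionGaussianLemma.lean` then proves Cor. 1.4 from Thm. 1.3.

## Contents (all proved; elementary real analysis on `ℤ^d`)

* lattice partial sums `Σ_{y ∈ Λ_N} ⟦y⟧^{-s} ≤ 1 + 2d 3^{d-1} N^{d-s}` for `0 ≤ s ≤ d - 1`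
  (`sum_box_jnorm_rpow_neg_le`, shells `|∂Λ_k| ≤ 2d 3^{d-1} k^{d-1}` of
  `LaceExpansionHighDimensionProofs.lean`), and the form over `Λ_{⌈|x|⌉}`;
* the uniform convolution bound `Σ_y ⟦x-y⟧^{-α}⟦y⟧^{-β} ≤ 2 Σ_z ⟦z⟧^{-(α+β)}` for `α, β ≥ 0`,
  `α + β > d` (`summable_jnorm_conv`; the mechanism of Lemma 6.1(i));
* a second-order mean-value bound for real powers (`abs_rpow_sub_rpow_sub_linear_le`) and the
  resulting **Taylor bound for the Riesz kernel** on the lattice (`taylor_riesz_bound`):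
  `| |x-y|^{2-d} - |x|^{2-d} - (d-2)|x|^{-d}(x·y) | ≤ C_d |y|²|x|^{-d}` for `|x| ≥ 2`,
  `|y| ≤ |x|/2` (`sdot x y = x·y`, `taylorRieszConst d = C_d`);
* the inner region `innerRegion x = {y : |y| ≤ |x|/2}` as a symmetric finite set and the
  cancellation `Σ_{|y| ≤ |x|/2} (x·y) g(y) = 0` for even `g` (`sum_innerRegion_sdot_mul_eq_zero`) —
  the role of the `ℤ^d`-symmetry hypothesis in Lemma 6.1(ii).

## References

* T. Hara, *Decay of correlations in nearest-neighbor self-avoiding walk, percolation, lattice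
  trees and animals*, Ann. Probab. 36 (2008) 530–593 (arXiv:math-ph/0504021): §1.1 (notation
  `⟦x⟧ = |x| ∨ 1`), §1.2.2 (Cor. 1.4 and its one-line proof), §6 Lemma 6.1 (i)–(iv) and the proof
  of (iii) (splitting at `|y| < |x|/2`).
* T. Hara, R. van der Hofstad, G. Slade, Ann. Probab. 31 (2003) 349–408, Prop. 1.7 (the source of
  Lemma 6.1(i)–(ii); cited through Hara 2008).
-/

noncomputable section

namespace Literature.Barriers.CriticalPhenomena

open MeasureTheory Filter Finset Literature.Probability.LatticeModels Literature.Probability.Percolation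
open scoped Topology BigOperators

variable {d : ℕ}

/-! ### Lattice partial sums `Σ_{y ∈ Λ_N} ⟦y⟧^{-s} ≤ C N^{d-s}` for `0 ≤ s ≤ d - 1` -/

/-- `‖y‖_∞ ≤ ⟦y⟧`. [folklore] -/
theorem norm_le_jnorm (y : Site d) : ‖y‖ ≤ jnorm y :=
  (norm_le_euclidNorm y).trans (euclidNorm_le_jnorm y)

/-- `(‖y‖_∞ : ℕ-valued sup norm) ≤ ⟦y⟧`. [folklore] -/
theorem supNorm_le_jnorm (y : Site d) : (Site.supNorm y : ℝ) ≤ jnorm y := by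
  rw [← Site.norm_eq_supNorm]; exact norm_le_jnorm y

/-- On the punctured lattice, `⟦y⟧^{-s} ≤ ‖y‖_∞^{-s}` for `s ≥ 0`. [folklore] -/
theorem jnorm_rpow_neg_le_supNorm_rpow_neg {y : Site d} (hy : y ≠ 0) {s : ℝ} (hs : 0 ≤ s) :
    jnorm y ^ (-s) ≤ (Site.supNorm y : ℝ) ^ (-s) := by
  have hpos : 0 < (Site.supNorm y : ℝ) := by
    have h : Site.supNorm y ≠ 0 := fun h => hy (Site.supNorm_eq_zero_iff.1 h)
    exact_mod_cast Nat.pos_of_ne_zero h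
  exact Real.rpow_le_rpow_of_nonpos hpos (supNorm_le_jnorm y) (by linarith)

/-- **Lattice partial sums.** For `0 ≤ s ≤ d - 1` (`d ≥ 1`) and every `N`,
`Σ_{y ∈ Λ_N} ⟦y⟧^{-s} ≤ 1 + 2d·3^{d-1} N^{d-s}` (shell decomposition `|∂Λ_k| ≤ 2d 3^{d-1} k^{d-1}`
and `k^{d-1-s} ≤ N^{d-1-s}`). [folklore] -/
theorem sum_box_jnorm_rpow_neg_le (hd : 1 ≤ d) {s : ℝ} (hs0 : 0 ≤ s) (hs : s ≤ (d : ℝ) - 1) (N : ℕ) :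
    ∑ y ∈ box d N, jnorm y ^ (-s) ≤ 1 + 2 * d * 3 ^ (d - 1) * (N : ℝ) ^ ((d : ℝ) - s) := by
  classical
  have h0 : (0 : Site d) ∈ box d N := zero_mem_box d N
  rw [← Finset.add_sum_erase _ _ h0, jnorm_zero, Real.one_rpow]
  gcongr
  -- compare with a function of the sup norm and decompose into shells
  have hle : ∑ y ∈ (box d N).erase 0, jnorm y ^ (-s) ≤
      ∑ y ∈ (box d N).erase 0, (fun k : ℕ => (k : ℝ) ^ (-s)) (Site.supNorm y) :=
    Finset.sum_le_sum fun y hy => jnorm_rpow_neg_le_supNorm_rpow_neg (Finset.ne_of_mem_erase hy) hs0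
  refine hle.trans ?_
  rw [sum_box_erase_zero_eq_sum_range (fun k : ℕ => (k : ℝ) ^ (-s)) N]
  have hds : 0 ≤ (d : ℝ) - 1 - s := by linarith
  have hterm : ∀ k ∈ Finset.range N, (#(sphere d (k + 1)) : ℝ) * (((k + 1 : ℕ) : ℝ) ^ (-s)) ≤
      2 * d * 3 ^ (d - 1) * (N : ℝ) ^ ((d : ℝ) - 1 - s) := by
    intro k hk
    have hk1 : (0 : ℝ) < (k : ℝ) + 1 := by positivity
    have hkN : (k : ℝ) + 1 ≤ N := by exact_mod_cast Finset.mem_range.1 hk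
    have hcard := card_sphere_succ_le' hd k
    push_cast
    calc (#(sphere d (k + 1)) : ℝ) * (((k : ℝ) + 1) ^ (-s))
        ≤ 2 * d * 3 ^ (d - 1) * ((k : ℝ) + 1) ^ (d - 1) * (((k : ℝ) + 1) ^ (-s)) := by
          gcongr
      _ = 2 * d * 3 ^ (d - 1) * ((k : ℝ) + 1) ^ ((d : ℝ) - 1 - s) := by
          rw [mul_assoc, ← Real.rpow_natCast ((k : ℝ) + 1) (d - 1), ← Real.rpow_add hk1,
            Nat.cast_sub hd]
          ring_nf
      _ ≤ 2 * d * 3 ^ (d - 1) * (N : ℝ) ^ ((d : ℝ) - 1 - s) := by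
          gcongr
  calc ∑ k ∈ Finset.range N, (#(sphere d (k + 1)) : ℝ) * (((k + 1 : ℕ) : ℝ) ^ (-s))
      ≤ ∑ k ∈ Finset.range N, (2 * d * 3 ^ (d - 1) * (N : ℝ) ^ ((d : ℝ) - 1 - s) : ℝ) :=
        Finset.sum_le_sum hterm
    _ = 2 * d * 3 ^ (d - 1) * ((N : ℝ) * (N : ℝ) ^ ((d : ℝ) - 1 - s)) := by
        rw [Finset.sum_const, Finset.card_range]; ring
    _ ≤ 2 * d * 3 ^ (d - 1) * (N : ℝ) ^ ((d : ℝ) - s) := by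
        rcases Nat.eq_zero_or_pos N with hN | hN
        · subst hN; simp; positivity
        · have hN' : (0 : ℝ) < N := by exact_mod_cast hN
          rw [← Real.rpow_one_add' hN'.le (by linarith)]
          ring_nf
          rfl


/-- The form used below: for `⟦x⟧ ≥ 1`, `Σ_{y ∈ Λ_{⌈|x|⌉}} ⟦y⟧^{-s} ≤ (1 + 2d 3^{d-1} 2^{d-s}) |x|^{d-s}`
(`⌈|x|⌉ ≤ 2|x|`). [folklore] -/
theorem sum_box_ceil_jnorm_rpow_neg_le (hd : 1 ≤ d) {s : ℝ} (hs0 : 0 ≤ s) (hs : s ≤ (d : ℝ) - 1)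
    {x : Site d} (hx : 1 ≤ euclidNorm x) :
    ∑ y ∈ box d ⌈euclidNorm x⌉₊, jnorm y ^ (-s) ≤
      (1 + 2 * d * 3 ^ (d - 1) * 2 ^ ((d : ℝ) - s)) * euclidNorm x ^ ((d : ℝ) - s) := by
  have hxpos : 0 < euclidNorm x := by linarith
  have hds : 0 ≤ (d : ℝ) - s := by linarith
  have hceil : (⌈euclidNorm x⌉₊ : ℝ) ≤ 2 * euclidNorm x := by
    have := Nat.ceil_lt_add_one hxpos.le
    linarith
  have h1 : (1 : ℝ) ≤ euclidNorm x ^ ((d : ℝ) - s) := Real.one_le_rpow hx hds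
  calc ∑ y ∈ box d ⌈euclidNorm x⌉₊, jnorm y ^ (-s)
      ≤ 1 + 2 * d * 3 ^ (d - 1) * (⌈euclidNorm x⌉₊ : ℝ) ^ ((d : ℝ) - s) :=
        sum_box_jnorm_rpow_neg_le hd hs0 hs _
    _ ≤ 1 + 2 * d * 3 ^ (d - 1) * (2 * euclidNorm x) ^ ((d : ℝ) - s) := by gcongr
    _ = 1 + 2 * d * 3 ^ (d - 1) * 2 ^ ((d : ℝ) - s) * euclidNorm x ^ ((d : ℝ) - s) := by
        rw [Real.mul_rpow (by norm_num) hxpos.le]; ring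
    _ ≤ (1 + 2 * d * 3 ^ (d - 1) * 2 ^ ((d : ℝ) - s)) * euclidNorm x ^ ((d : ℝ) - s) := by
        rw [add_mul, one_mul]
        gcongr

/-! ### The uniform convolution bound `Σ_y ⟦x-y⟧^{-α} ⟦y⟧^{-β} ≤ 2 Σ_z ⟦z⟧^{-(α+β)}` -/

/-- Pointwise: `⟦x-y⟧^{-α}⟦y⟧^{-β} ≤ ⟦x-y⟧^{-(α+β)} + ⟦y⟧^{-(α+β)}` for `α, β ≥ 0` (compare the two
regularised norms). [folklore] -/
theorem jnorm_rpow_mul_le_add (x y : Site d) {α β : ℝ} (hα : 0 ≤ α) (hβ : 0 ≤ β) :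
    jnorm (x - y) ^ (-α) * jnorm y ^ (-β) ≤ jnorm (x - y) ^ (-(α + β)) + jnorm y ^ (-(α + β)) := by
  have h1 := jnorm_pos (x - y)
  have h2 := jnorm_pos y
  have hA : 0 ≤ jnorm (x - y) ^ (-(α + β)) := Real.rpow_nonneg h1.le _
  have hB : 0 ≤ jnorm y ^ (-(α + β)) := Real.rpow_nonneg h2.le _
  rcases le_total (jnorm y) (jnorm (x - y)) with h | h
  · -- `⟦y⟧ ≤ ⟦x-y⟧`: `⟦x-y⟧^{-α} ≤ ⟦y⟧^{-α}`
    have hle : jnorm (x - y) ^ (-α) ≤ jnorm y ^ (-α) := Real.rpow_le_rpow_of_nonpos h2 h (by linarith)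
    calc jnorm (x - y) ^ (-α) * jnorm y ^ (-β) ≤ jnorm y ^ (-α) * jnorm y ^ (-β) := by
          gcongr
      _ = jnorm y ^ (-(α + β)) := by rw [← Real.rpow_add h2]; ring_nf
      _ ≤ _ := by linarith
  · have hle : jnorm y ^ (-β) ≤ jnorm (x - y) ^ (-β) := Real.rpow_le_rpow_of_nonpos h1 h (by linarith)
    calc jnorm (x - y) ^ (-α) * jnorm y ^ (-β) ≤ jnorm (x - y) ^ (-α) * jnorm (x - y) ^ (-β) := by
          gcongr
      _ = jnorm (x - y) ^ (-(α + β)) := by rw [← Real.rpow_add h1]; ring_nf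
      _ ≤ _ := by linarith

/-- Reflection-translation invariance: `Σ_y F(x - y) = Σ_z F(z)`. [folklore] -/
theorem tsum_comp_sub_left (F : Site d → ℝ) (x : Site d) : ∑' y, F (x - y) = ∑' z, F z :=
  (Equiv.subLeft x).tsum_eq F

/-- Reflection-translation invariance of summability. [folklore] -/
theorem summable_comp_sub_left {F : Site d → ℝ} (hF : Summable F) (x : Site d) :
    Summable fun y => F (x - y) :=
  (Equiv.subLeft x).summable_iff.2 hF

/-- **Uniform convolution bound** (the mechanism of Hara 2008, Lemma 6.1(i) in the regime
`α + β > d`): for `α, β ≥ 0` with `α + β > d`, the lattice convolution of `⟦·⟧^{-α}` and `⟦·⟧^{-β}`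
is summable and bounded by `2 Σ_z ⟦z⟧^{-(α+β)}`, uniformly in `x`.
[cite: Hara2008, Lemma 6.1(i)] -/
theorem summable_jnorm_conv {α β : ℝ} (hα : 0 ≤ α) (hβ : 0 ≤ β) (h : (d : ℝ) < α + β) (x : Site d) :
    Summable (fun y => jnorm (x - y) ^ (-α) * jnorm y ^ (-β)) ∧
      ∑' y, jnorm (x - y) ^ (-α) * jnorm y ^ (-β) ≤ 2 * ∑' z : Site d, jnorm z ^ (-(α + β)) := by
  have hs : Summable fun z : Site d => jnorm z ^ (-(α + β)) := summable_jnorm_rpow_neg h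
  have hs' : Summable fun y : Site d => jnorm (x - y) ^ (-(α + β)) := summable_comp_sub_left hs x
  have hmaj : Summable fun y => jnorm (x - y) ^ (-(α + β)) + jnorm y ^ (-(α + β)) := hs'.add hs
  have hnn : ∀ y, 0 ≤ jnorm (x - y) ^ (-α) * jnorm y ^ (-β) := fun y =>
    mul_nonneg (Real.rpow_nonneg (jnorm_pos _).le _) (Real.rpow_nonneg (jnorm_pos _).le _)
  have hsum : Summable fun y => jnorm (x - y) ^ (-α) * jnorm y ^ (-β) :=
    Summable.of_nonneg_of_le hnn (fun y => jnorm_rpow_mul_le_add x y hα hβ) hmaj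
  refine ⟨hsum, ?_⟩
  calc ∑' y, jnorm (x - y) ^ (-α) * jnorm y ^ (-β)
      ≤ ∑' y, (jnorm (x - y) ^ (-(α + β)) + jnorm y ^ (-(α + β))) :=
        Summable.tsum_le_tsum (fun y => jnorm_rpow_mul_le_add x y hα hβ) hsum hmaj
    _ = 2 * ∑' z : Site d, jnorm z ^ (-(α + β)) := by
        rw [Summable.tsum_add hs' hs, tsum_comp_sub_left (fun z => jnorm z ^ (-(α + β))) x]; ring

/-! ### Second-order Taylor bound for the Riesz kernel `⟦x⟧^{2-d}` -/

/-- **Second-order mean-value bound for real powers**: for `u, w ≥ m > 0` and `p ≤ 2`... more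
precisely for any real `p` with `p - 2 ≤ 0`,
`|u^p - w^p - p w^{p-1}(u - w)| ≤ |p| |p-1| m^{p-2} (u - w)²` (two applications of the mean
value theorem to `s ↦ s^p` and `s ↦ s^{p-1}` on `[m, ∞)`). [folklore] -/
theorem abs_rpow_sub_rpow_sub_linear_le {p m u w : ℝ} (hp : p - 2 ≤ 0) (hm : 0 < m) (hu : m ≤ u)
    (hw : m ≤ w) :
    |u ^ p - w ^ p - p * w ^ (p - 1) * (u - w)| ≤ |p| * |p - 1| * m ^ (p - 2) * (u - w) ^ 2 := by
  -- mean value theorem for `s ↦ s^q` between two points of `[m, ∞)`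
  have mvt : ∀ (q a b : ℝ), m ≤ a → m ≤ b → a ≠ b →
      ∃ ξ, m ≤ ξ ∧ |ξ - b| ≤ |a - b| ∧ ξ ≠ b ∧ a ^ q - b ^ q = q * ξ ^ (q - 1) * (a - b) := by
    intro q a b ha hb hab
    have key : ∀ (lo hi : ℝ), m ≤ lo → lo < hi →
        ∃ ξ ∈ Set.Ioo lo hi, q * ξ ^ (q - 1) = (hi ^ q - lo ^ q) / (hi - lo) := by
      intro lo hi hlo hlt
      have hpos : ∀ s ∈ Set.Icc lo hi, s ≠ 0 := fun s hs => by
        have : 0 < s := lt_of_lt_of_le (lt_of_lt_of_le hm hlo) hs.1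
        exact this.ne'
      refine exists_hasDerivAt_eq_slope (fun s => s ^ q) (fun s => q * s ^ (q - 1)) hlt ?_ ?_
      · exact fun s hs => (Real.continuousAt_rpow_const s q (Or.inl (hpos s hs))).continuousWithinAt
      · intro s hs
        exact Real.hasDerivAt_rpow_const (Or.inl (hpos s (Set.Ioo_subset_Icc_self hs)))
    rcases lt_or_gt_of_ne hab with hlt | hlt
    · obtain ⟨ξ, ⟨h1, h2⟩, hξ⟩ := key a b ha hlt
      refine ⟨ξ, by linarith, ?_, by linarith [h2], ?_⟩
      · rw [abs_of_neg (by linarith : ξ - b < 0), abs_of_neg (by linarith : a - b < 0)]; linarith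
      · rw [hξ]
        field_simp [sub_ne_zero.2 hlt.ne', sub_ne_zero.2 hlt.ne]
        ring
    · obtain ⟨ξ, ⟨h1, h2⟩, hξ⟩ := key b a hb hlt
      refine ⟨ξ, by linarith, ?_, by linarith [h1], ?_⟩
      · rw [abs_of_pos (by linarith : 0 < ξ - b), abs_of_pos (by linarith : 0 < a - b)]; linarith
      · rw [hξ, div_mul_cancel₀ _ (sub_ne_zero.2 hlt.ne')]
  rcases eq_or_ne u w with huw | huw
  · subst huw; simp
  obtain ⟨ξ, hξm, hξb, hξw, h1⟩ := mvt p u w hu hw huw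
  obtain ⟨η, hηm, -, -, h2⟩ := mvt (p - 1) ξ w hξm hw hξw
  have hη : 0 < η := lt_of_lt_of_le hm hηm
  have hexpr : u ^ p - w ^ p - p * w ^ (p - 1) * (u - w) =
      p * (p - 1) * η ^ (p - 2) * ((ξ - w) * (u - w)) := by
    rw [h1, show p * ξ ^ (p - 1) * (u - w) - p * w ^ (p - 1) * (u - w) =
      p * (ξ ^ (p - 1) - w ^ (p - 1)) * (u - w) by ring, h2]
    ring_nf
  rw [hexpr, abs_mul, abs_mul, abs_mul, abs_mul, abs_of_pos (Real.rpow_pos_of_pos hη _)]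
  have hηp : η ^ (p - 2) ≤ m ^ (p - 2) := Real.rpow_le_rpow_of_nonpos hm hηm hp
  have hprod : |ξ - w| * |u - w| ≤ (u - w) ^ 2 := by
    rw [← sq_abs (u - w), sq]
    exact mul_le_mul_of_nonneg_right hξb (abs_nonneg _)
  calc |p| * |p - 1| * η ^ (p - 2) * (|ξ - w| * |u - w|)
      ≤ |p| * |p - 1| * m ^ (p - 2) * (u - w) ^ 2 := by gcongr


/-- The Euclidean inner product `x·y = Σ_i x_i y_i` of two lattice points, as a real number.
[cite: Hara2008, §1.1 Notation] -/
def sdot (x y : Site d) : ℝ := ∑ i, ((x i : ℤ) : ℝ) * ((y i : ℤ) : ℝ)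

/-- `x·(-y) = -(x·y)`. [folklore] -/
theorem sdot_neg_right (x y : Site d) : sdot x (-y) = -sdot x y := by
  simp [sdot, Finset.sum_neg_distrib, mul_neg]

/-- `|x - y|² = |x|² - 2 x·y + |y|²`. [folklore] -/
theorem euclidNorm_sub_sq (x y : Site d) :
    euclidNorm (x - y) ^ 2 = euclidNorm x ^ 2 - 2 * sdot x y + euclidNorm y ^ 2 := by
  rw [euclidNorm_sq, euclidNorm_sq, euclidNorm_sq, sdot, Finset.mul_sum, ← Finset.sum_sub_distrib,
    ← Finset.sum_add_distrib]
  refine Finset.sum_congr rfl fun i _ => ?_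
  push_cast [Pi.sub_apply]
  ring

/-- Cauchy–Schwarz: `|x·y| ≤ |x| |y|`. [folklore] -/
theorem abs_sdot_le (x y : Site d) : |sdot x y| ≤ euclidNorm x * euclidNorm y := by
  have h := Finset.sum_mul_sq_le_sq_mul_sq Finset.univ (fun i => ((x i : ℤ) : ℝ)) (fun i => ((y i : ℤ) : ℝ))
  have h' : (sdot x y) ^ 2 ≤ (euclidNorm x * euclidNorm y) ^ 2 := by
    rw [mul_pow, euclidNorm_sq, euclidNorm_sq]; exact h
  have := Real.sqrt_le_sqrt h'
  rwa [Real.sqrt_sq_eq_abs, Real.sqrt_sq (mul_nonneg (euclidNorm_nonneg x) (euclidNorm_nonneg y))] at this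

/-- Reverse triangle inequality in the form `|x| - |y| ≤ |x - y|`. [folklore] -/
theorem euclidNorm_sub_euclidNorm_le (x y : Site d) : euclidNorm x - euclidNorm y ≤ euclidNorm (x - y) := by
  have h := euclidNorm_add_le (x - y) y
  rw [sub_add_cancel] at h
  linarith

/-- `|x|^{2-d}` as a power of `|x|²`: `|x|^{2-d} = (|x|²)^{(2-d)/2}`. [folklore] -/
theorem euclidNorm_rpow_eq_sq_rpow (x : Site d) (a : ℝ) :
    euclidNorm x ^ a = (euclidNorm x ^ 2) ^ (a / 2) := by
  rw [show euclidNorm x ^ 2 = euclidNorm x ^ (2 : ℝ) by norm_cast, ← Real.rpow_mul (euclidNorm_nonneg x)]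
  congr 1; ring

/-- The constant of the Taylor bound `taylor_riesz_bound`. [folklore] -/
def taylorRieszConst (d : ℕ) : ℝ :=
  ((d : ℝ) - 2) / 2 * ((d : ℝ) / 2) * 4 ^ (2 - (2 - (d : ℝ)) / 2) * (25 / 4) + ((d : ℝ) - 2) / 2

/-- `taylorRieszConst d ≥ 0` for `d ≥ 2`. [folklore] -/
theorem taylorRieszConst_nonneg (hd : 2 ≤ d) : 0 ≤ taylorRieszConst d := by
  have : (2 : ℝ) ≤ d := by exact_mod_cast hd
  unfold taylorRieszConst
  positivity

/-- **Second-order Taylor bound for the Riesz kernel on the lattice.** For `d ≥ 2`, `|x| ≥ 2` and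
`|y| ≤ |x|/2`:
`| |x-y|^{2-d} - |x|^{2-d} - (d-2)|x|^{-d} (x·y) | ≤ C_d |y|² |x|^{-d}` — the linear term of the
expansion of `|x-y|^{2-d}` in `y` is odd in `y`, the rest is second order (applied to
`s ↦ s^{(2-d)/2}` at `s = |x|²`, `|x-y|² - |x|² = -2x·y + |y|²`, on `[|x|²/4, ∞)`). This is the
estimate behind the `ℤ^d`-symmetry hypothesis of Lemma 6.1(ii). [cite: Hara2008, Lemma 6.1(ii)] -/
theorem taylor_riesz_bound (hd : 2 ≤ d) {x y : Site d} (hx : 2 ≤ euclidNorm x)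
    (hy : euclidNorm y ≤ euclidNorm x / 2) :
    |euclidNorm (x - y) ^ (2 - (d : ℝ)) - euclidNorm x ^ (2 - (d : ℝ)) -
        ((d : ℝ) - 2) * euclidNorm x ^ (-(d : ℝ)) * sdot x y| ≤
      taylorRieszConst d * euclidNorm y ^ 2 * euclidNorm x ^ (-(d : ℝ)) := by
  set ex := euclidNorm x with hex
  set ey := euclidNorm y with hey
  set exy := euclidNorm (x - y) with hexy
  set S := sdot x y with hS
  set p : ℝ := (2 - (d : ℝ)) / 2 with hp
  have hd' : (2 : ℝ) ≤ d := by exact_mod_cast hd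
  have hex0 : 0 < ex := by linarith
  have hey0 : 0 ≤ ey := euclidNorm_nonneg y
  have hexy_ge : ex / 2 ≤ exy := by
    have := euclidNorm_sub_euclidNorm_le x y
    linarith
  have hexy0 : 0 < exy := by linarith
  -- the variables of the one-dimensional lemma
  set u := exy ^ 2 with hu
  set w := ex ^ 2 with hw
  set m := ex ^ 2 / 4 with hm
  have hm0 : 0 < m := by positivity
  have hmu : m ≤ u := by
    rw [hm, hu]
    have : (ex / 2) ^ 2 ≤ exy ^ 2 := pow_le_pow_left₀ (by positivity) hexy_ge 2
    linarith [this]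
  have hmw : m ≤ w := by rw [hm, hw]; linarith [sq_nonneg ex]
  have hp2 : p - 2 ≤ 0 := by rw [hp]; linarith
  have key := abs_rpow_sub_rpow_sub_linear_le (p := p) hp2 hm0 hmu hmw
  -- translate the powers
  have hup : u ^ p = exy ^ (2 - (d : ℝ)) := by rw [hu, euclidNorm_rpow_eq_sq_rpow]
  have hwp : w ^ p = ex ^ (2 - (d : ℝ)) := by rw [hw, euclidNorm_rpow_eq_sq_rpow]
  have hwp1 : w ^ (p - 1) = ex ^ (-(d : ℝ)) := by
    rw [hw, euclidNorm_rpow_eq_sq_rpow x (-(d : ℝ))]; congr 1; rw [hp]; ring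
  have huw : u - w = -2 * S + ey ^ 2 := by rw [hu, hw, hexy, euclidNorm_sub_sq]; ring
  have hmp : m ^ (p - 2) = 4 ^ (2 - p) * ex ^ (-(d : ℝ) - 2) := by
    rw [hm, Real.div_rpow (sq_nonneg ex) (by norm_num : (0 : ℝ) ≤ 4),
      show (ex ^ 2) ^ (p - 2) = ex ^ (-(d : ℝ) - 2) by
        rw [euclidNorm_rpow_eq_sq_rpow x (-(d : ℝ) - 2)]; congr 1; rw [hp]; ring,
      div_eq_mul_inv, ← Real.rpow_neg (by norm_num : (0 : ℝ) ≤ 4), neg_sub, mul_comm]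
  -- the main identity
  have hT : exy ^ (2 - (d : ℝ)) - ex ^ (2 - (d : ℝ)) - ((d : ℝ) - 2) * ex ^ (-(d : ℝ)) * S =
      (u ^ p - w ^ p - p * w ^ (p - 1) * (u - w)) + p * ex ^ (-(d : ℝ)) * ey ^ 2 := by
    rw [hup, hwp, hwp1, huw, hp]; ring
  rw [hT]
  -- bound the two pieces
  have hS : |S| ≤ ex * ey := abs_sdot_le x y
  have huw2 : (u - w) ^ 2 ≤ 25 / 4 * (ex ^ 2 * ey ^ 2) := by
    rw [huw]
    have h1 : |-2 * S + ey ^ 2| ≤ 5 / 2 * (ex * ey) := by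
      calc |-2 * S + ey ^ 2| ≤ |-2 * S| + |ey ^ 2| := abs_add_le _ _
        _ = 2 * |S| + ey * ey := by
            rw [abs_mul, abs_of_nonneg (sq_nonneg ey), sq, abs_of_nonpos (by norm_num : (-2 : ℝ) ≤ 0)]
            norm_num
        _ ≤ 2 * (ex * ey) + ex / 2 * ey := by gcongr
        _ = 5 / 2 * (ex * ey) := by ring
    calc (-2 * S + ey ^ 2) ^ 2 = |-2 * S + ey ^ 2| ^ 2 := (sq_abs _).symm
      _ ≤ (5 / 2 * (ex * ey)) ^ 2 := pow_le_pow_left₀ (abs_nonneg _) h1 2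
      _ = 25 / 4 * (ex ^ 2 * ey ^ 2) := by ring
  have hpabs : |p| = ((d : ℝ) - 2) / 2 := by
    rw [hp, abs_of_nonpos (by linarith)]; ring
  have hp1abs : |p - 1| = (d : ℝ) / 2 := by
    rw [hp, abs_of_nonpos (by linarith)]; ring
  have hfirst : |u ^ p - w ^ p - p * w ^ (p - 1) * (u - w)| ≤
      ((d : ℝ) - 2) / 2 * ((d : ℝ) / 2) * 4 ^ (2 - p) * (25 / 4) * ey ^ 2 * ex ^ (-(d : ℝ)) := by
    refine key.trans ?_
    rw [hpabs, hp1abs, hmp]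
    have hsplit : ex ^ (-(d : ℝ) - 2) * (ex ^ 2 * ey ^ 2) = ey ^ 2 * ex ^ (-(d : ℝ)) := by
      have : ex ^ (-(d : ℝ) - 2) * ex ^ 2 = ex ^ (-(d : ℝ)) := by
        rw [show ex ^ 2 = ex ^ (2 : ℝ) by norm_cast, ← Real.rpow_add hex0]; ring_nf
      calc ex ^ (-(d : ℝ) - 2) * (ex ^ 2 * ey ^ 2) = (ex ^ (-(d : ℝ) - 2) * ex ^ 2) * ey ^ 2 := by ring
        _ = ey ^ 2 * ex ^ (-(d : ℝ)) := by rw [this]; ring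
    calc (d - 2 : ℝ) / 2 * ((d : ℝ) / 2) * (4 ^ (2 - p) * ex ^ (-(d : ℝ) - 2)) * (u - w) ^ 2
        ≤ (d - 2 : ℝ) / 2 * ((d : ℝ) / 2) * (4 ^ (2 - p) * ex ^ (-(d : ℝ) - 2)) *
            (25 / 4 * (ex ^ 2 * ey ^ 2)) := by
          gcongr
      _ = (d - 2 : ℝ) / 2 * ((d : ℝ) / 2) * 4 ^ (2 - p) * (25 / 4) *
            (ex ^ (-(d : ℝ) - 2) * (ex ^ 2 * ey ^ 2)) := by ring
      _ = _ := by rw [hsplit]; ring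
  have hsecond : |p * ex ^ (-(d : ℝ)) * ey ^ 2| = ((d : ℝ) - 2) / 2 * ey ^ 2 * ex ^ (-(d : ℝ)) := by
    rw [abs_mul, abs_mul, hpabs, abs_of_nonneg (Real.rpow_nonneg hex0.le _), abs_of_nonneg (sq_nonneg _)]
    ring
  calc |u ^ p - w ^ p - p * w ^ (p - 1) * (u - w) + p * ex ^ (-(d : ℝ)) * ey ^ 2|
      ≤ |u ^ p - w ^ p - p * w ^ (p - 1) * (u - w)| + |p * ex ^ (-(d : ℝ)) * ey ^ 2| := abs_add_le _ _
    _ ≤ ((d : ℝ) - 2) / 2 * ((d : ℝ) / 2) * 4 ^ (2 - p) * (25 / 4) * ey ^ 2 * ex ^ (-(d : ℝ)) +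
          ((d : ℝ) - 2) / 2 * ey ^ 2 * ex ^ (-(d : ℝ)) := by rw [hsecond]; gcongr
    _ = taylorRieszConst d * ey ^ 2 * ex ^ (-(d : ℝ)) := by rw [taylorRieszConst, hp]; ring


/-! ### The inner region `{y : |y| ≤ |x|/2}` as a symmetric finite set -/

/-- The inner region `{y ∈ ℤ^d : |y| ≤ |x|/2}` of the splitting in the proof of Lemma 6.1, realised
as a finite set (inside the box `Λ_{⌈|x|⌉}`). [cite: Hara2008, proof of Lemma 6.1(iii) (T₁, T₂)] -/
def innerRegion (x : Site d) : Finset (Site d) :=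
  (box d ⌈euclidNorm x⌉₊).filter fun y => euclidNorm y ≤ euclidNorm x / 2

/-- A point with `|y| ≤ R` lies in the box `Λ_{⌈R⌉}`. [folklore] -/
theorem mem_box_ceil_of_euclidNorm_le {y : Site d} {R : ℝ} (h : euclidNorm y ≤ R) :
    y ∈ box d ⌈R⌉₊ := by
  rw [mem_box]
  intro i
  have hi : |((y i : ℤ) : ℝ)| ≤ (⌈R⌉₊ : ℝ) :=
    ((abs_apply_le_euclidNorm y i).trans h).trans (Nat.le_ceil R)
  have hi' : |y i| ≤ (⌈R⌉₊ : ℤ) := by exact_mod_cast hi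
  exact abs_le.1 hi'

/-- Membership in the inner region is the condition `|y| ≤ |x|/2`. [folklore] -/
theorem mem_innerRegion {x y : Site d} : y ∈ innerRegion x ↔ euclidNorm y ≤ euclidNorm x / 2 := by
  rw [innerRegion, Finset.mem_filter]
  constructor
  · exact fun h => h.2
  · intro h
    refine ⟨mem_box_ceil_of_euclidNorm_le (h.trans ?_), h⟩
    linarith [euclidNorm_nonneg x]

/-- The inner region is symmetric under `y ↦ -y`. [folklore] -/
theorem neg_mem_innerRegion {x y : Site d} (h : y ∈ innerRegion x) : -y ∈ innerRegion x := by
  rw [mem_innerRegion] at h ⊢; rwa [euclidNorm_neg]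

/-- The inner region lies in the box `Λ_{⌈|x|⌉}`. [folklore] -/
theorem innerRegion_subset_box (x : Site d) : innerRegion x ⊆ box d ⌈euclidNorm x⌉₊ :=
  Finset.filter_subset _ _

/-- **The symmetric cancellation**: `Σ_{|y| ≤ |x|/2} (x·y) g(y) = 0` for even `g`.
[cite: Hara2008, Lemma 6.1(ii) (ℤ^d-symmetry hypothesis)] -/
theorem sum_innerRegion_sdot_mul_eq_zero {g : Site d → ℝ} (hge : ∀ y, g (-y) = g y) (x : Site d) :
    ∑ y ∈ innerRegion x, sdot x y * g y = 0 := by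
  refine Finset.sum_involution (fun y _ => -y) ?_ ?_ ?_ ?_
  · intro y _; rw [sdot_neg_right, hge]; ring
  · intro y _ hne h
    have hy : y = 0 := by
      have h2 : (2 : ℤ) • y = 0 := by rw [two_smul]; nth_rewrite 1 [← h]; simp
      exact (smul_eq_zero.1 h2).resolve_left (by norm_num)
    apply hne; subst hy; simp [sdot]
  · intro y hy; exact neg_mem_innerRegion hy
  · intro y _; simp

/-- Outside the inner region, `|y| > |x|/2`. [folklore] -/
theorem lt_euclidNorm_of_not_mem_innerRegion {x y : Site d} (h : y ∉ innerRegion x) :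
    euclidNorm x / 2 < euclidNorm y := by
  rw [mem_innerRegion, not_le] at h; exact h

/-- The Riesz weight is at most one: `⟦z⟧^{2-d} ≤ 1` for `d ≥ 2`. [folklore] -/
theorem jnorm_rpow_two_sub_le_one (hd : 2 ≤ d) (z : Site d) : jnorm z ^ (2 - (d : ℝ)) ≤ 1 := by
  have : (2 : ℝ) ≤ d := by exact_mod_cast hd
  exact Real.rpow_le_one_of_one_le_of_nonpos (one_le_jnorm z) (by linarith)

/-- A function dominated by `K ⟦y⟧^{-(d+ρ)}`, `ρ > 0`, is absolutely summable. [folklore] -/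
theorem summable_abs_of_le_jnorm_rpow_neg {g : Site d → ℝ} {C ρ : ℝ}
    (hg : ∀ y, |g y| ≤ C * jnorm y ^ (-((d : ℝ) + ρ))) (hρ : 0 < ρ) :
    Summable fun y => |g y| :=
  Summable.of_nonneg_of_le (fun y => abs_nonneg _) hg
    ((summable_jnorm_rpow_neg (by linarith : (d : ℝ) < d + ρ)).mul_left C)

end Literature.Barriers.CriticalPhenomena
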